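import Summits.AtomisticToContinuum.BoseEinsteinCondensation.Theorems.BoxLatticeFSumShellModeCountingProof
import HarnessLib

/-!
# `BoxLatticeFSum` box line after MC: `BoseEinsteinCondensation ⟸ MF ∧ SB ∧ DE`  (decomp-a2c · hand-1 g9)

With ZS (`zeroScatteringBEC_holds`, lens-6 g29) and MC (`boxShellModeCounting_holds`, this generation) proved,
the node kernel `bec_of_boxPieces` of `…Theorems.BoxLatticeFSumCarving` needs only the mixed floor MF, the
shell budget SB and the residual DE.  No definitions, no `sorry`. [folklore]
-/

noncomputable section

namespace Summit.AtomisticToContinuum.BoseEinsteinCondensation.Theorems.BoxLatticeFSum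

/-- **The conjunct from the three remaining box pieces**: `MF → SB → DE → BoseEinsteinCondensation`
(MC and ZS discharged by `boxShellModeCounting_holds` and `zeroScatteringBEC_holds`). [folklore] -/
theorem bec_of_mixedFloor_shellBudget_deep (hMF : BoxMixedFloor) (hSB : BoxShellBudget)
    (hDE : BoxDeepInfraredEmptiness) : _root_.BoseEinsteinCondensation :=
  bec_of_boxPieces hMF hSB hDE boxShellModeCounting_holds zeroScatteringBEC_holds

/-- The same with SB read as its conclusion `BoxShellBound` (SB := MF → BoxShellBound). [folklore] -/
theorem bec_of_mixedFloor_shellBound_deep (hMF : BoxMixedFloor) (hB : BoxShellBound)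
    (hDE : BoxDeepInfraredEmptiness) : _root_.BoseEinsteinCondensation :=
  bec_of_mixedFloor_shellBudget_deep hMF (fun _ => hB) hDE

end Summit.AtomisticToContinuum.BoseEinsteinCondensation.Theorems.BoxLatticeFSum

end
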